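import Summits.ABC.ABC.Theorems.IneffectiveSubspaceDepthCountedABCStubCellZeroQuarticThue
import Summits.ABC.ABC.Theorems.IneffectiveSubspaceDepthCountedABCStubFibreRoth

/-!
# Stub `stub_cellZeroLittleO` of line `Sketch` — crux `DepthCountedABC` (stmt-ABC-14938)

WHAT.  On the 5-free cell `#{p : v_p(abc) ≥ 5} = 0` (every prime has exponent `≤ 4` in `abc`) the
free bound is `c < √2·rad(abc)²`; this certificate records what Roth's theorem (PROVED in the tree)
gives unconditionally one step further: `c = o(rad(abc)²)`, i.e. for every `κ > 0` there is `c₀` such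
that every 5-free abc triple with `c ≥ c₀` has `c < κ·rad(abc)²`.

MECHANISM.  Fix `κ > 0`, choose a natural `B ≥ 16/κ⁸`, let `Z₁` be the uniform Roth threshold with
saving `η = 1` over the finite box of binomial quartic forms `wZ⁴ − vY⁴`, `1 ≤ v, w ≤ B`
(`fibreRoth_box`), put `M = max Z₁ B` and take any natural `c₀ > 8M⁴/κ⁶`.  Given a 5-free abc triple,
order it `a ≤ b` (everything is symmetric in `a, b`) and suppose `κ·rad² ≤ c`.  The elementary
bookkeeping `quarticThue_natBounds` writes `b = uY⁴`, `c = vZ⁴` with `a·u·v·c⁸ ≤ 16·rad¹⁶` and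
`c⁷ ≤ 8·rad¹²·Z⁴`; with `rad² ≤ c/κ` this gives `a·u·v ≤ 16/κ⁸ ≤ B` (so `a, u, v ≤ B`) and
`c ≤ 8Z⁴/κ⁶`.  If `Z ≥ Z₁`, Roth on the box gives `Z < |vZ⁴ − uY⁴| = a ≤ B`; otherwise `Z < Z₁`.
Either way `Z ≤ M`, whence `c ≤ 8M⁴/κ⁶ < c₀`, so `c < c₀`: the triples with `c ≥ c₀` all satisfy
`c < κ·rad²`.  (Ineffective: `Z₁` comes from Roth's theorem.)

Sources: skeleton `Cruxes/DepthCountedABC/Lines/Sketch.lean` (lead c23), stub `stub_cellZeroLittleO`.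
Ingredients: `Summit.ABC.ABC.Theorems.DepthCountedABC.quarticThue_natBounds` and
`Summit.ABC.ABC.Theorems.DepthCountedABC.calibration_fiveFree_of_card_eq_zero`
(`Theorems/IneffectiveSubspaceDepthCountedABCStubCellZeroQuarticThue.lean`, `…StubCalibration.lean`),
`Summit.ABC.ABC.Theorems.DepthCountedABC.fibreRoth_box`
(`Theorems/IneffectiveSubspaceDepthCountedABCStubFibreRoth.lean`; ultimately
`Literature.NumberTheory.DiophantineGeometry.roth_holds`, Roth's theorem, PROVED in the tree),
`Literature.NumberTheory.DiophantineGeometry.rad_def`, and Mathlib (`exists_nat_ge`, `exists_nat_gt`,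
`Real.rpow_one`, `le_div_iff₀`, `pow_le_pow_left₀`, `le_of_mul_le_mul_right`).  No unproved facts.
Deliberately NOT here: the converse on the 5-free locus (`stub_thueOfCellZeroLittleO`), the cell-1
analogue, and any power saving `rad^(2−δ)` (equivalent to a UNIFORM quartic Thue statement, open).
-/

-- `Summit.<Summit>.<Problem>` is the mandated summit-side namespace (CONVENTIONS §2); for the
-- single-conjunct summit `ABC` the two coincide, so the duplicate `ABC.ABC` is deliberate.
set_option linter.dupNamespace false

namespace Summit.ABC.ABC.Theorems.DepthCountedABC

open Literature.NumberTheory.DiophantineGeometry (IsABCTriple rad rad_def) in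
/-- **Stub `stub_cellZeroLittleO` of line `Sketch`, crux `DepthCountedABC` (stmt-ABC-14938):**
`c = o(rad(abc)²)` on the 5-free cell.  For every `κ > 0` there is `c₀` such that every abc triple with
`#{p : v_p(abc) ≥ 5} = 0` and `c ≥ c₀` satisfies `c < κ·rad(abc)²` (Roth's theorem with saving `1`,
uniform over the finite box of binomial quartic forms `vZ⁴ − uY⁴` with `u, v ≤ 16/κ⁸`; ineffective).
[cite: Roth1955] -/
theorem stub_cellZeroLittleO : ∀ κ : ℝ, 0 < κ → ∃ c₀ : ℕ, ∀ a b c : ℕ,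
    Literature.NumberTheory.DiophantineGeometry.IsABCTriple a b c →
    ((a * b * c).primeFactors.filter (fun p => 5 ≤ (a * b * c).factorization p)).card = 0 →
    c₀ ≤ c → (c : ℝ) < κ * ((Literature.NumberTheory.DiophantineGeometry.rad a b c : ℕ) : ℝ) ^ 2 := by
  intro κ hκ
  -- the finite box of sub-quartic layers, the uniform Roth threshold over it, and the constant
  obtain ⟨B, hB⟩ : ∃ B : ℕ, 16 / κ ^ 8 ≤ (B : ℝ) := exists_nat_ge _
  obtain ⟨Z₁, hZ₁⟩ := fibreRoth_box B (show (1 : ℝ) < 2 by norm_num)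
  obtain ⟨M, hM₁, hM₂⟩ : ∃ M : ℕ, Z₁ ≤ M ∧ B ≤ M := ⟨max Z₁ B, le_max_left _ _, le_max_right _ _⟩
  obtain ⟨c₀, hc₀⟩ : ∃ c₀ : ℕ, 8 * (M : ℝ) ^ 4 / κ ^ 6 < (c₀ : ℝ) := exists_nat_gt _
  refine ⟨c₀, ?_⟩
  intro a b c habc h0 hc₀c
  -- WLOG `a ≤ b` (all data are symmetric in `a, b`)
  wlog hab : a ≤ b generalizing a b with Hsymm
  · have hsw : IsABCTriple b a c :=
      ⟨habc.2.1, habc.1, by rw [add_comm]; exact habc.2.2.1, habc.2.2.2.symm⟩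
    have hprod : b * a * c = a * b * c := by ring
    have h0' : ((b * a * c).primeFactors.filter (fun p => 5 ≤ (b * a * c).factorization p)).card = 0 := by
      rw [hprod]; exact h0
    have := Hsymm b a hsw h0' (le_of_not_ge hab)
    rwa [rad_def, hprod, ← rad_def] at this
  -- the ordered case: elementary bookkeeping of the 5-free triple
  have h4 : ∀ p ∈ (a * b * c).primeFactors, (a * b * c).factorization p ≤ 4 :=
    calibration_fiveFree_of_card_eq_zero h0
  obtain ⟨u, v, Y, Z, hbuY, hcvZ, hu, hv, -, -, hF5, hF6, -⟩ := quarticThue_natBounds habc hab h4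
  obtain ⟨ha, -, hsum, -⟩ := habc
  set R := rad a b c with hR
  by_contra! hexc
  -- `hexc : κ·R² ≤ c`; positivity of the letters
  have hcpos : (0 : ℝ) < (c : ℝ) := by exact_mod_cast (show 0 < c by omega)
  have hR0 : (0 : ℝ) ≤ (R : ℝ) := Nat.cast_nonneg _
  -- `R² ≤ c/κ` and its powers
  have hR2 : (R : ℝ) ^ 2 ≤ (c : ℝ) / κ := by
    rw [le_div_iff₀ hκ, mul_comm]; exact hexc
  have hR16 : (R : ℝ) ^ 16 ≤ ((c : ℝ) / κ) ^ 8 :=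
    calc (R : ℝ) ^ 16 = ((R : ℝ) ^ 2) ^ 8 := by ring
      _ ≤ ((c : ℝ) / κ) ^ 8 := pow_le_pow_left₀ (by positivity) hR2 8
  have hR12 : (R : ℝ) ^ 12 ≤ ((c : ℝ) / κ) ^ 6 :=
    calc (R : ℝ) ^ 12 = ((R : ℝ) ^ 2) ^ 6 := by ring
      _ ≤ ((c : ℝ) / κ) ^ 6 := pow_le_pow_left₀ (by positivity) hR2 6
  -- real forms of the two bookkeeping inequalities
  have hF5R : ((a * u * v : ℕ) : ℝ) * (c : ℝ) ^ 8 ≤ 16 * (R : ℝ) ^ 16 := by exact_mod_cast hF5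
  have hF6R : (c : ℝ) ^ 7 ≤ 8 * (R : ℝ) ^ 12 * (Z : ℝ) ^ 4 := by exact_mod_cast hF6
  -- `a·u·v ≤ 16/κ⁸ ≤ B`, hence `a, u, v ≤ B`
  have hauvR : ((a * u * v : ℕ) : ℝ) ≤ 16 / κ ^ 8 := by
    have h1 : ((a * u * v : ℕ) : ℝ) * (c : ℝ) ^ 8 ≤ (16 / κ ^ 8) * (c : ℝ) ^ 8 :=
      calc ((a * u * v : ℕ) : ℝ) * (c : ℝ) ^ 8 ≤ 16 * (R : ℝ) ^ 16 := hF5R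
        _ ≤ 16 * ((c : ℝ) / κ) ^ 8 := mul_le_mul_of_nonneg_left hR16 (by norm_num)
        _ = (16 / κ ^ 8) * (c : ℝ) ^ 8 := by rw [div_pow]; ring
    exact le_of_mul_le_mul_right h1 (by positivity)
  have hauv : a * u * v ≤ B := by exact_mod_cast hauvR.trans hB
  have haB : a ≤ B :=
    ((Nat.le_mul_of_pos_right a hu).trans (Nat.le_mul_of_pos_right _ hv)).trans hauv
  have huB : u ≤ B :=
    ((Nat.le_mul_of_pos_left u ha).trans (Nat.le_mul_of_pos_right _ hv)).trans hauv
  have hvB : v ≤ B := (Nat.le_mul_of_pos_left v (Nat.mul_pos ha hu)).trans hauv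
  -- the binomial quartic Thue equation `a + uY⁴ = vZ⁴`, and Roth over the box: `Z ≤ M`
  have heq : a + u * Y ^ 4 = v * Z ^ 4 := by rw [← hbuY, ← hcvZ, hsum]
  have hne : v * Z ^ 4 ≠ u * Y ^ 4 := by omega
  have hZM : Z ≤ M := by
    rcases Nat.lt_or_ge Z Z₁ with hlt | hge
    · exact hlt.le.trans hM₁
    · have hroth := hZ₁ u v Y Z hge hu hv huB hvB hne
      have habs : |((v * Z ^ 4 : ℕ) : ℝ) - ((u * Y ^ 4 : ℕ) : ℝ)| = (a : ℝ) := by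
        have hdiff : ((v * Z ^ 4 : ℕ) : ℝ) - ((u * Y ^ 4 : ℕ) : ℝ) = (a : ℝ) := by
          rw [sub_eq_iff_eq_add]
          exact_mod_cast (by omega : v * Z ^ 4 = a + u * Y ^ 4)
        rw [hdiff, abs_of_pos (by exact_mod_cast ha)]
      rw [habs, Real.rpow_one] at hroth
      have hZa : Z < a := by exact_mod_cast hroth
      exact (hZa.le.trans haB).trans hM₂
  -- `c⁷ ≤ 8·rad¹²·Z⁴ ≤ (8M⁴/κ⁶)·c⁶`, so `c ≤ 8M⁴/κ⁶ < c₀ ≤ c`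
  have hZM4 : (Z : ℝ) ^ 4 ≤ (M : ℝ) ^ 4 := by exact_mod_cast Nat.pow_le_pow_left hZM 4
  have hc7 : (c : ℝ) * (c : ℝ) ^ 6 ≤ (8 * (M : ℝ) ^ 4 / κ ^ 6) * (c : ℝ) ^ 6 :=
    calc (c : ℝ) * (c : ℝ) ^ 6 = (c : ℝ) ^ 7 := by ring
      _ ≤ 8 * (R : ℝ) ^ 12 * (Z : ℝ) ^ 4 := hF6R
      _ ≤ 8 * ((c : ℝ) / κ) ^ 6 * (M : ℝ) ^ 4 :=
          mul_le_mul (mul_le_mul_of_nonneg_left hR12 (by norm_num)) hZM4 (by positivity)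
            (by positivity)
      _ = (8 * (M : ℝ) ^ 4 / κ ^ 6) * (c : ℝ) ^ 6 := by rw [div_pow]; ring
  have hcle : (c : ℝ) ≤ 8 * (M : ℝ) ^ 4 / κ ^ 6 := le_of_mul_le_mul_right hc7 (by positivity)
  have hc₀R : (c₀ : ℝ) ≤ (c : ℝ) := by exact_mod_cast hc₀c
  linarith

end Summit.ABC.ABC.Theorems.DepthCountedABC
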